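import Mathlib.LinearAlgebra.Matrix.NonsingularInverse
import Mathlib.LinearAlgebra.Matrix.ToLin
import Mathlib.LinearAlgebra.Determinant
import Mathlib.LinearAlgebra.Dimension.RankNullity
import Mathlib.LinearAlgebra.FiniteDimensional.Lemmas
import Mathlib.RingTheory.LocalRing.ResidueField.Basic
import Mathlib.Algebra.Ring.GeomSum
import HarnessLib

/-!
# Two algebraic lemmas behind the level clause of the odd-`p` Hecke theta partner (bricks LM-A of `stub_levelMatch_ns`)

Route `SignedLowerHalves`, child L `SmallImageLowerHalfBothSigns` (item stmt-BirchSwinnertonDyer-23599), line `rtt_w3`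
(v2 proposal `Lines/rtt_w3_v2.lean`, stub `stub_levelMatch_ns`: for every weight-`2` CM newform `g` on `Γ₀(M)` congruent
to `W` off `p·M·N_W`, `max 2 (v_ℓ M) = max 2 (v_ℓ N_W)` at every `ℓ ≠ p`; width seat `bsd-line-slh-p3-w3` gen 10; memo
`Lines/birth_acns-MEMO-w3-g10.md` §4).  THEOREMS ONLY (no definition, no named fact, no `sorry`); Mathlib-only imports.

The level clause rests on two facts about a `2`-dimensional representation at a prime `ℓ ≠ p` (memo §4): (d) on the mod-`p`
and on the `p`-adic side a finite group of order prime to the characteristic with trivial determinant fixes either nothing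
or everything, and (b′) an element of `GL_n(𝒪)` of finite order prime to `p` that is trivial modulo `𝔪` is trivial.  This
file proves their algebraic cores:

* `LinearMap.eq_one_of_apply_eq_of_det_eq_one_of_pow_eq_one` — on a `2`-dimensional vector space over a field `k`, an
  endomorphism `u` with a non-zero fixed vector, `det u = 1` and `u ^ N = 1` for some `N` with `(N : k) ≠ 0` is the identity
  (in a basis `(v, w)`: `u = [[1, a], [0, 1]]`, `u ^ N = [[1, N a], [0, 1]]`);
* `Module.End.forall_eq_one_of_exists_fixed` — hence (DICHOTOMY) a family of such endomorphisms with a COMMON non-zero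
  fixed vector is trivial: the common fixed space of a finite group of exponent invertible in `k` acting with determinant
  `1` on `k²` is `0` or everything;
* `Matrix.eq_one_of_map_residue_eq_one_of_pow_eq_one` — over a local ring `𝒪`, a square matrix `x` with `x ≡ 1 (mod 𝔪)`
  and `x ^ N = 1`, `N` a unit of `𝒪`, is `1` (`0 = x^N − 1 = (Σ_{j<N} x^j)(x − 1)` and `Σ x^j ≡ N·1` is invertible).

BSD, crux L and the stub are NOT proved here.

References: J.-P. Serre, Corps locaux IV §2, VI §2; J.-P. Serre, Duke Math. J. 54 (1987) §4.6; folklore.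
-/

set_option autoImplicit false
set_option linter.dupNamespace false

noncomputable section

open Module Matrix

namespace Summit.BirchSwinnertonDyer.BirchSwinnertonDyer.Theorems.SmallImageLambdaLowerThreeNsThetaPartner

/-! ### §1. Unipotent endomorphisms of finite order prime to the characteristic, in dimension `2` -/

section Unipotent

variable {k : Type*} [Field k] {V : Type*} [AddCommGroup V] [Module k V]

/-- Powers of an upper unitriangular `2 × 2` matrix: `[[1, a], [0, 1]] ^ N = [[1, N a], [0, 1]]`. [folklore] -/
theorem Matrix.unitriangular_two_pow (a : k) (N : ℕ) :
    (!![1, a; 0, 1] : Matrix (Fin 2) (Fin 2) k) ^ N = !![1, (N : k) * a; 0, 1] := by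
  induction N with
  | zero => simp [Matrix.one_fin_two]
  | succ n ih =>
    rw [pow_succ, ih, Matrix.mul_fin_two]
    have h01 : (1 : k) * a + (n : k) * a = ((n + 1 : ℕ) : k) * a := by push_cast; ring
    simp only [mul_one, mul_zero, add_zero, zero_mul, zero_add, h01]

/-- **A unipotent of finite order prime to the characteristic is trivial (dimension `2`).**  Let `V` be a `2`-dimensional
vector space over the field `k`, `u` an endomorphism with a non-zero fixed vector `v`, `det u = 1`, and `u ^ N = 1` with
`(N : k) ≠ 0`.  Then `u = 1`. [folklore] -/
theorem LinearMap.eq_one_of_apply_eq_of_det_eq_one_of_pow_eq_one (h2 : finrank k V = 2) (u : V →ₗ[k] V) {v : V}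
    (hv : v ≠ 0) (huv : u v = v) (hdet : LinearMap.det u = 1) {N : ℕ} (hN : (N : k) ≠ 0) (hpow : u ^ N = 1) :
    u = 1 := by
  classical
  -- a basis `b = (v, w)`
  obtain ⟨w, hvw⟩ := exists_linearIndependent_pair_of_one_lt_finrank (by rw [h2]; norm_num) hv
  have hcard : Fintype.card (Fin 2) = finrank k V := by rw [h2]; simp
  let b : Basis (Fin 2) k V := basisOfLinearIndependentOfCardEqFinrank hvw hcard
  have hb0 : b 0 = v := by simp [b]
  -- the matrix of `u` is `[[1, a], [0, d]]` with `d = det u = 1`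
  set A : Matrix (Fin 2) (Fin 2) k := LinearMap.toMatrix b b u with hA
  have hcol : ∀ i, A i 0 = if i = 0 then 1 else 0 := by
    intro i
    rw [hA, LinearMap.toMatrix_apply, hb0, huv, ← hb0, b.repr_self]
    simp [Finsupp.single_apply, eq_comm]
  have hA00 : A 0 0 = 1 := by rw [hcol]; simp
  have hA10 : A 1 0 = 0 := by rw [hcol]; simp
  have hdetA : A.det = 1 := by rw [hA, LinearMap.det_toMatrix]; exact hdet
  have hA11 : A 1 1 = 1 := by
    rw [Matrix.det_fin_two, hA00, hA10] at hdetA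
    simpa using hdetA
  have hAeq : A = !![1, A 0 1; 0, 1] := by
    ext i j
    fin_cases i <;> fin_cases j <;> simp [hA00, hA10, hA11]
  -- `A ^ N = 1` forces `a = 0`
  have hApow : A ^ N = 1 := by
    rw [hA, LinearMap.toMatrix_pow, hpow]
    exact LinearMap.toMatrix_one b
  rw [hAeq, Matrix.unitriangular_two_pow] at hApow
  have h01 : (N : k) * A 0 1 = 0 := by
    have := congrArg (fun M : Matrix (Fin 2) (Fin 2) k => M 0 1) hApow
    simpa using this
  have ha : A 0 1 = 0 := by
    rcases mul_eq_zero.mp h01 with h | h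
    · exact absurd h hN
    · exact h
  have hA1 : A = 1 := by
    rw [hAeq, ha]
    ext i j
    fin_cases i <;> fin_cases j <;> simp
  -- back to `u`
  have : LinearMap.toMatrix b b u = LinearMap.toMatrix b b 1 := by rw [← hA, hA1, LinearMap.toMatrix_one]
  exact (LinearMap.toMatrix b b).injective this

/-- **Dichotomy (the form used for inertia groups with trivial determinant).**  On a `2`-dimensional space, a family of
endomorphisms `u i` of determinant `1` and of orders dividing some `N` with `(N : k) ≠ 0`, with a COMMON non-zero fixed
vector, is trivial: `u i = 1` for all `i`.  Equivalently, the common fixed subspace of such a family is `0` or the whole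
space. [folklore] -/
theorem Module.End.forall_eq_one_of_exists_fixed (h2 : finrank k V = 2) {ι : Type*} (u : ι → (V →ₗ[k] V))
    (hdet : ∀ i, LinearMap.det (u i) = 1) {N : ℕ} (hN : (N : k) ≠ 0) (hpow : ∀ i, u i ^ N = 1)
    {v : V} (hv : v ≠ 0) (hfix : ∀ i, u i v = v) : ∀ i, u i = 1 :=
  fun i => LinearMap.eq_one_of_apply_eq_of_det_eq_one_of_pow_eq_one h2 (u i) hv (hfix i) (hdet i) hN (hpow i)

end Unipotent

/-! ### §2. Torsion prime to `p` in the kernel of reduction is trivial -/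

section Reduction

variable {𝒪 : Type*} [CommRing 𝒪] [IsLocalRing 𝒪] {n : Type*} [Fintype n] [DecidableEq n]

/-- Reduction of matrices modulo the maximal ideal is a ring homomorphism; a matrix reducing to `1` has all its powers
reducing to `1`. [folklore] -/
theorem Matrix.map_residue_pow_eq_one {x : Matrix n n 𝒪} (hx : x.map (IsLocalRing.residue 𝒪) = 1) (j : ℕ) :
    (x ^ j).map (IsLocalRing.residue 𝒪) = 1 := by
  have h : (IsLocalRing.residue 𝒪).mapMatrix (x ^ j) = ((IsLocalRing.residue 𝒪).mapMatrix x) ^ j := map_pow _ _ _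
  rw [RingHom.mapMatrix_apply] at h
  rw [h, RingHom.mapMatrix_apply, hx, one_pow]

/-- **An element of `GL_n(𝒪)` of finite order prime to `p`, trivial mod `𝔪`, is trivial.**  Over a local ring `𝒪`, if
`x ≡ 1 (mod 𝔪)` entrywise, `x ^ N = 1` and `N` is a unit of `𝒪` (i.e. the residue characteristic does not divide
`N`), then `x = 1`: `0 = x ^ N − 1 = (Σ_{j<N} x^j) · (x − 1)` and `Σ_{j<N} x^j ≡ N · 1 (mod 𝔪)` has unit determinant.
[cite: Serre1987, §4.6 (proof of Lemme 5)] -/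
theorem Matrix.eq_one_of_map_residue_eq_one_of_pow_eq_one {x : Matrix n n 𝒪}
    (hx : x.map (IsLocalRing.residue 𝒪) = 1) {N : ℕ} (hN : IsUnit (N : 𝒪)) (hpow : x ^ N = 1) : x = 1 := by
  classical
  set S : Matrix n n 𝒪 := ∑ j ∈ Finset.range N, x ^ j with hS
  -- `S * (x - 1) = x ^ N - 1 = 0`
  have hgeom : S * (x - 1) = 0 := by rw [hS, geom_sum_mul, hpow, sub_self]
  -- `S ≡ N • 1 (mod 𝔪)`, so `det S` is a unit
  have hSres : S.map (IsLocalRing.residue 𝒪) =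
      ((N : ℕ) : IsLocalRing.ResidueField 𝒪) • (1 : Matrix n n (IsLocalRing.ResidueField 𝒪)) := by
    have h : (IsLocalRing.residue 𝒪).mapMatrix S = ∑ j ∈ Finset.range N, (IsLocalRing.residue 𝒪).mapMatrix (x ^ j) := by
      rw [hS, map_sum]
    rw [RingHom.mapMatrix_apply] at h
    rw [h]
    simp_rw [RingHom.mapMatrix_apply, Matrix.map_residue_pow_eq_one hx]
    rw [Finset.sum_const, Finset.card_range, Nat.cast_smul_eq_nsmul]
  have hdet : IsUnit S.det := by
    rw [← IsLocalRing.residue_ne_zero_iff_isUnit, RingHom.map_det, RingHom.mapMatrix_apply, hSres, Matrix.det_smul,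
      Matrix.det_one, mul_one]
    have hNres : (IsLocalRing.residue 𝒪) (N : 𝒪) ≠ 0 := (IsLocalRing.residue_ne_zero_iff_isUnit _).mpr hN
    rw [map_natCast] at hNres
    exact pow_ne_zero _ hNres
  have hSunit : IsUnit S := (Matrix.isUnit_iff_isUnit_det S).mpr hdet
  -- cancel `S`
  have hx1 : x - 1 = 0 := by
    obtain ⟨u, hu⟩ := hSunit
    have h := congrArg (fun M => (↑u⁻¹ : Matrix n n 𝒪) * M) hgeom
    simp only [mul_zero] at h
    rwa [← hu, ← mul_assoc, Units.inv_mul, one_mul] at h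
  exact sub_eq_zero.mp hx1

end Reduction

end Summit.BirchSwinnertonDyer.BirchSwinnertonDyer.Theorems.SmallImageLambdaLowerThreeNsThetaPartner

end
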